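import Summits.QuantumFields.QCD.Theses.SpectralDefectExtinction
import Literature.Barriers.QuantumFields.WilsonDeterminantSign
import Literature.MathematicalPhysics.QuantumLattice.OverlapLocality
import Literature.MathematicalPhysics.QuantumFieldTheory.QCDPhaseQuenched

/-!
# Sketch — crux idea `determinant-tilt-kinematic-sign` (crux stmt-QuantumFields-18064,
# `SpectralDefectExtinction.ExtinctionBuildsQCD`, SD⁺ → THR; crux-ideate round 2, ideator 4)

First lemmas of the line "KINEMATIC SIGN RESTORATION": the all-volume sign module of the bridge needs
NO physical-rate localisation theorem, because

* (TILT, §1, PROVED) under the phase-quenched measure the Radon–Nikodym factor `∏_f |det D_W(m_f(k))| =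
  ∏_f ∏_j |λ_j(Γ₅D_W(m_f(k)))|` (tree: `fermionDet_wilsonDirac_eq_prod_eigenvalues`) vanishes to order
  `n_f ≥ 1` at a zero mode of flavour `f`, so the law of a well's level `λ` is the quenched conditional law
  tilted by `|λ|^{n_f}`: for ANY measure `ν` on `ℝ` and any `τ ≤ θ`,
  `(∫_{|λ|<τ} |λ|ⁿ dν) · θⁿ ν{|λ| ≥ θ} ≤ τⁿ ν{|λ|<τ} · ∫_{|λ|≥θ} |λ|ⁿ dν` (`tilt_lintegral`) — a fixed-quantile
  ANTI-CONCENTRATION of the quenched conditional law (`ν{|λ| ≥ θw | well} ≥ η`) is upgraded to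
  non-resonance AT EVERY SCALE `τ`, `P₊(|λ| < τ | well) ≤ (τ/θw)ⁿ/η`, hence to the finite log-moment
  `E₊[log⁴(w/|λ|) | well] < ∞` that summability of two-well resonances over the distance needs (§2);
* (TWO WELLS, §2, PROVED) the resonant-wells counter-model of TRIAGE-r1-3 (`H = ε σₓ`, `sgn H = σₓ`) is
  quantified: the off-diagonal entry of `sgn [[e₁,τ],[τ,e₂]]` is `0` or `|τ|/√((e₁−e₂)²/4+τ²)`, and in the
  second case `(|e₁|+|e₂|)² ≤ (e₁−e₂)² + 4τ²` (`two_well_resonance`), i.e. hybridisation of two wells at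
  tunnelling amplitude `τ(d) = A e^{−κ₁θwd}` (landed W3) needs BOTH levels within `O(τ(d))` of zero;
* (RARITY BEATS REACH, §4, PROVED in the abstract) along a POLYGROWTH witness (`a_k L_k ≥ a_k^{-q}`, §3 —
  met by `canonicalAF`, hence safe and not junk-excluding, `canonicalAF_polyGrowth`) the sign-defect polymer gas
  with KINEMATIC range `R_k = Z_k/(κ₁θ c a_k m)` and first-moment density `ρ_k ≤ ε/(2L_k+1)⁴` (EXTINCT) has a
  truncated-correlation rate `(1/R_k) log(1/(ρ_k R_k⁴))` per lattice unit, which in PHYSICAL units is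
  `≥ (κ₁θcm/Z_k)·(4q log a_k⁻¹ − O(log Z_k)) → ∞` (`rate_diverges`: `Z_k ≤ C (log a_k⁻¹)^γ`, `γ = γ₀/2β₀ < 1`):
  the sign sector is eventually MORE massive than any physical gap, so the honest `HasLatticeMassGap Δ` rate is
  the PQ core's `Δ`, and weyl-window's Stub 2/2⁺/5 may be re-typed with k-dependent kinematic constants;
* (§5, typed targets, `sorry`) the crux-facing statements the line registers: level-scaling of wells under
  `⟨·⟩₊` (`levelScaling_target`, the NR input in W4's bad-box predicate at two levels) and kinematic
  Fermi-projector screening (`kinematicScreening_target`, Stub 2⁺ with rate `κ·(a_k m_f/Z_k)` per lattice unit and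
  a constant polynomial in `Z_k/a_k`).

`lean check`: see the card (`idea-determinant-tilt-kinematic-sign.md`, field `First lemma`).
-/

noncomputable section

namespace Summit.QuantumFields.QCD.Cruxes.ExtinctionBuildsQCD.DeterminantTilt

open scoped BigOperators Topology Classical MeasureTheory Matrix ENNReal
open Filter MeasureTheory Matrix Asymptotics
open Literature.MathematicalPhysics.QuantumLattice Literature.MathematicalPhysics.QuantumFieldTheory
  Literature.Probability.LatticeModels
open Literature.Barriers.QuantumFields.WilsonDeterminant
open Summit.QuantumFields.QCD.Theses.SpectralDefectExtinction

/-! ## §1 The tilt lemma (the lever): `|λ|ⁿ`-tilting turns a fixed-quantile anti-concentration into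
non-resonance at every scale -/

/-- **The determinant tilt.** For any measure `ν` on `ℝ` (the quenched conditional law of a well's level),
any exponent `n` (the number of flavours degenerate with `f`, `n ≥ 1` in use) and scales `0 ≤ τ`, `0 ≤ θ`:
`(∫_{|x|<τ} |x|ⁿ dν) · (θⁿ · ν{θ ≤ |x|}) ≤ (τⁿ · ν{|x| < τ}) · ∫_{θ≤|x|} |x|ⁿ dν`.  Read with the tilted law
`dν₊ ∝ |x|ⁿ dν`: `ν₊{|x| < τ} ≤ (τ/θ)ⁿ · ν{|x|<τ}/ν{θ ≤ |x|}` — no density (Wegner) bound on `ν` is used.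
[folklore] -/
theorem tilt_lintegral (ν : Measure ℝ) (n : ℕ) {τ θ : ℝ} (hθ : 0 ≤ θ) :
    (∫⁻ x in {x : ℝ | |x| < τ}, ENNReal.ofReal (|x| ^ n) ∂ν) * (ENNReal.ofReal (θ ^ n) * ν {x : ℝ | θ ≤ |x|}) ≤
      (ENNReal.ofReal (τ ^ n) * ν {x : ℝ | |x| < τ}) * ∫⁻ x in {x : ℝ | θ ≤ |x|}, ENNReal.ofReal (|x| ^ n) ∂ν := by
  have hS : MeasurableSet {x : ℝ | |x| < τ} :=
    measurableSet_lt continuous_abs.measurable measurable_const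
  have hT : MeasurableSet {x : ℝ | θ ≤ |x|} :=
    measurableSet_le measurable_const continuous_abs.measurable
  have h1 : ∫⁻ x in {x : ℝ | |x| < τ}, ENNReal.ofReal (|x| ^ n) ∂ν ≤
      ENNReal.ofReal (τ ^ n) * ν {x : ℝ | |x| < τ} := by
    calc ∫⁻ x in {x : ℝ | |x| < τ}, ENNReal.ofReal (|x| ^ n) ∂ν
        ≤ ∫⁻ _ in {x : ℝ | |x| < τ}, ENNReal.ofReal (τ ^ n) ∂ν :=
          setLIntegral_mono' hS fun x hx =>
            ENNReal.ofReal_le_ofReal (pow_le_pow_left₀ (abs_nonneg x) (le_of_lt hx) n)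
      _ = ENNReal.ofReal (τ ^ n) * ν {x : ℝ | |x| < τ} := setLIntegral_const _ _
  have h2 : ENNReal.ofReal (θ ^ n) * ν {x : ℝ | θ ≤ |x|} ≤
      ∫⁻ x in {x : ℝ | θ ≤ |x|}, ENNReal.ofReal (|x| ^ n) ∂ν := by
    calc ENNReal.ofReal (θ ^ n) * ν {x : ℝ | θ ≤ |x|}
        = ∫⁻ _ in {x : ℝ | θ ≤ |x|}, ENNReal.ofReal (θ ^ n) ∂ν := (setLIntegral_const _ _).symm
      _ ≤ ∫⁻ x in {x : ℝ | θ ≤ |x|}, ENNReal.ofReal (|x| ^ n) ∂ν :=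
          setLIntegral_mono' hT fun x hx => ENNReal.ofReal_le_ofReal (pow_le_pow_left₀ hθ hx n)
  exact mul_le_mul' h1 h2

/-- **Finite form of the tilt** (a well level sampled `N` times; weights `|xᵢ|ⁿ`): the tilted mass below `τ`
times `θⁿ · #{θ ≤ |xᵢ|}` is at most `τⁿ · #{|xᵢ| < τ}` times the tilted mass above `θ`.  (The form the
card's kit toy j026024 measures.) [folklore] -/
theorem tilt_finset {ι : Type*} (s : Finset ι) (x : ι → ℝ) (n : ℕ) {τ θ : ℝ} (hθ : 0 ≤ θ) :
    (∑ i ∈ s.filter (fun i => |x i| < τ), |x i| ^ n) * (θ ^ n * ((s.filter fun i => θ ≤ |x i|).card : ℝ)) ≤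
      (τ ^ n * ((s.filter fun i => |x i| < τ).card : ℝ)) * ∑ i ∈ s.filter (fun i => θ ≤ |x i|), |x i| ^ n := by
  have h1 : ∑ i ∈ s.filter (fun i => |x i| < τ), |x i| ^ n ≤ τ ^ n * ((s.filter fun i => |x i| < τ).card : ℝ) := by
    rw [mul_comm, ← nsmul_eq_mul, ← Finset.sum_const]
    -- `Finset.sum_const` gives `card • τ^n`; compare termwise
    refine Finset.sum_le_sum fun i hi => ?_
    exact pow_le_pow_left₀ (abs_nonneg _) (le_of_lt (Finset.mem_filter.1 hi).2) n
  have h2 : θ ^ n * ((s.filter fun i => θ ≤ |x i|).card : ℝ) ≤ ∑ i ∈ s.filter (fun i => θ ≤ |x i|), |x i| ^ n := by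
    rw [mul_comm, ← nsmul_eq_mul, ← Finset.sum_const]
    refine Finset.sum_le_sum fun i hi => ?_
    exact pow_le_pow_left₀ hθ (Finset.mem_filter.1 hi).2 n
  have hA : 0 ≤ ∑ i ∈ s.filter (fun i => |x i| < τ), |x i| ^ n :=
    Finset.sum_nonneg fun i _ => pow_nonneg (abs_nonneg _) n
  have hB : 0 ≤ θ ^ n * ((s.filter fun i => θ ≤ |x i|).card : ℝ) := by positivity
  exact mul_le_mul h1 h2 hB (le_trans hA h1)

/-! ## §2 Two wells: resonance needs BOTH levels near zero (answers TRIAGE-r1-3's `H = ε σₓ` model) -/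

/-- **Two-well resonance inequality.** For the real symmetric `H = [[e₁, τ], [τ, e₂]]`, `sgn H` has a
non-zero off-diagonal entry only when `det H = e₁e₂ − τ² < 0`, and then this entry is `|τ|/r`,
`r = √((e₁−e₂)²/4 + τ²)`; in that case `(|e₁| + |e₂|)² ≤ (e₁ − e₂)² + 4τ² = 4r²`, i.e.
`|sgn(H)₁₂| ≤ 2|τ|/(|e₁|+|e₂|)`: a large inter-well sign-matrix entry at tunnelling amplitude `τ` forces
BOTH well levels into `[-2|τ|, 2|τ|]`. [folklore] -/
theorem two_well_resonance {e₁ e₂ τ : ℝ} (h : e₁ * e₂ < τ ^ 2) :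
    (|e₁| + |e₂|) ^ 2 ≤ (e₁ - e₂) ^ 2 + 4 * τ ^ 2 := by
  have key : (|e₁| + |e₂|) ^ 2 = e₁ ^ 2 + e₂ ^ 2 + 2 * |e₁ * e₂| := by
    rw [abs_mul]; nlinarith [sq_abs e₁, sq_abs e₂]
  rcases le_or_gt 0 (e₁ * e₂) with hp | hn
  · rw [key, abs_of_nonneg hp]; nlinarith
  · rw [key, abs_of_neg hn]; nlinarith [sq_nonneg τ]

/-- The same in the form the Fermi-projector screening estimate consumes: under `e₁e₂ < τ²` (the only case
with a non-zero inter-well entry of `sgn H`), `|τ| / √((e₁−e₂)²/4 + τ²) ≤ 2|τ| / (|e₁| + |e₂|)`. [folklore] -/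
theorem two_well_sign_entry_le {e₁ e₂ τ : ℝ} (h : e₁ * e₂ < τ ^ 2) (h0 : 0 < |e₁| + |e₂|) :
    |τ| / Real.sqrt ((e₁ - e₂) ^ 2 / 4 + τ ^ 2) ≤ 2 * |τ| / (|e₁| + |e₂|) := by
  have hr : (|e₁| + |e₂|) / 2 ≤ Real.sqrt ((e₁ - e₂) ^ 2 / 4 + τ ^ 2) := by
    apply Real.le_sqrt_of_sq_le
    have := two_well_resonance h
    nlinarith
  have hpos : 0 < (|e₁| + |e₂|) / 2 := by linarith
  calc |τ| / Real.sqrt ((e₁ - e₂) ^ 2 / 4 + τ ^ 2)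
      ≤ |τ| / ((|e₁| + |e₂|) / 2) := div_le_div_of_nonneg_left (abs_nonneg τ) hpos hr
    _ = 2 * |τ| / (|e₁| + |e₂|) := by field_simp

/-! ## §3 POLYGROWTH: the class clause the rate lemma wants — met by the disprover's junk witness
`canonicalAF`, hence SAFE and NOT junk-excluding (same status as GROWTH, Disproof §10a) -/

/-- **POLYGROWTH** of a regularisation: the scheme torus is at least polynomially large in `1/a_k` in
PHYSICAL units, `∃ q > 0, ∀ᶠ k, a_k^{-q} ≤ a_k L_k` (implies GROWTH `a_k L_k/Z_k → ∞` under `HasMassScaling`,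
since `Z_k ≍ (log a_k⁻²)^{γ₀/2β₀}`). [folklore] -/
def PolyGrowth {Nf : ℕ} (reg : QCDRegularisation Nf) : Prop :=
  ∃ q : ℝ, 0 < q ∧ ∀ᶠ k : ℕ in atTop, ((reg.a k)⁻¹) ^ q ≤ reg.a k * (reg.L k : ℝ)

/-- **`canonicalAF` meets POLYGROWTH** (`a_k = 1/(k+1)`, `L_k = (k+1)²`, so `a_k L_k = k+1 = a_k⁻¹`: `q = 1`
with equality).  With `Negative.VolumeGrowth.sdPlusGrowthWithoutTight_canonicalAF` this re-runs the disprover's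
schema: adding POLYGROWTH to SD⁺ excludes no junk and TIGHT⁺ stays the only junk-excluding clause. [folklore] -/
theorem canonicalAF_polyGrowth (Nf : ℕ) : PolyGrowth (QCDRegularisation.canonicalAF Nf) := by
  refine ⟨1, one_pos, Filter.Eventually.of_forall fun k => ?_⟩
  have ha : (QCDRegularisation.canonicalAF Nf).a k = ((k : ℝ) + 1)⁻¹ := rfl
  have hL : ((QCDRegularisation.canonicalAF Nf).L k : ℝ) = ((k : ℝ) + 1) ^ 2 := by
    change (((k + 1) ^ 2 : ℕ) : ℝ) = _
    push_cast
    ring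
  rw [Real.rpow_one, ha, hL, inv_inv]
  have hk : (0 : ℝ) < (k : ℝ) + 1 := by positivity
  rw [pow_two, ← mul_assoc, inv_mul_cancel₀ hk.ne', one_mul]

/-! ## §4 Rarity beats reach: under POLYGROWTH the kinematic sign-sector rate diverges in physical units -/

/-- **Rarity beats reach (abstract form).** Let `x_k → ∞` (read `x_k = log a_k⁻¹`), `0 < Z_k ≤ C x_k^γ`
eventually with `γ < 1` (read `HasMassScaling`, `γ = γ₀/2β₀ = 12/29, 4/9`), and `q x_k ≤ ℓog_k` eventually
(read POLYGROWTH: `ℓog_k = log(κ₁θ c m · a_k L_k)`, any fixed shift absorbed).  Then for every `m > 0` and every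
constant `K` the physical sign-sector rate `(m / Z_k) · (ℓog_k − log Z_k − K)` — kinematic rate `∝ m/Z_k` times
`log(1/(ρ_k R_k⁴))/4 ≥ log(a_kL_k/Z_k) − K` — tends to `+∞`. [folklore] -/
theorem rate_diverges {x Z ℓog : ℕ → ℝ} {q γ C : ℝ} (hq : 0 < q) (hγ : γ < 1) (hC : 0 < C)
    (hx : Tendsto x atTop atTop) (hZpos : ∀ k, 0 < Z k)
    (hZ : ∀ᶠ k in atTop, Z k ≤ C * (x k) ^ γ) (hℓ : ∀ᶠ k in atTop, q * x k ≤ ℓog k)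
    {m : ℝ} (hm : 0 < m) (K : ℝ) :
    Tendsto (fun k => m / Z k * (ℓog k - Real.log (Z k) - K)) atTop atTop := by
  -- Step 1: `log` is little-o of the identity, composed with `x → ∞`
  have hlog : ∀ᶠ k in atTop, |γ| * Real.log (x k) + (Real.log C + K) ≤ q / 2 * x k := by
    have h1 : ∀ᶠ y : ℝ in atTop, ‖Real.log y‖ ≤ (q / (4 * (|γ| + 1))) * ‖y‖ :=
      (Asymptotics.isLittleO_iff.1 Real.isLittleO_log_id_atTop) (by positivity)
    have h2 : ∀ᶠ k in atTop, ‖Real.log (x k)‖ ≤ (q / (4 * (|γ| + 1))) * ‖x k‖ := hx.eventually h1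
    have h3 : ∀ᶠ k in atTop, (4 / q) * (Real.log C + K) ≤ x k := hx.eventually_ge_atTop _
    have h4 : ∀ᶠ k in atTop, (1 : ℝ) ≤ x k := hx.eventually_ge_atTop _
    filter_upwards [h2, h3, h4] with k hk2 hk3 hk4
    have hxpos : 0 < x k := by linarith
    rw [Real.norm_eq_abs, Real.norm_eq_abs, abs_of_pos hxpos] at hk2
    have hγ1 : 0 < |γ| + 1 := by positivity
    have e1 : |γ| * Real.log (x k) ≤ |γ| * (q / (4 * (|γ| + 1)) * x k) :=
      mul_le_mul_of_nonneg_left (le_trans (le_abs_self _) hk2) (abs_nonneg γ)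
    have e2 : |γ| * (q / (4 * (|γ| + 1)) * x k) ≤ q / 4 * x k := by
      rw [← mul_assoc]
      apply mul_le_mul_of_nonneg_right _ hxpos.le
      have hfrac : |γ| / (|γ| + 1) ≤ 1 := (div_le_one hγ1).2 (by linarith)
      calc |γ| * (q / (4 * (|γ| + 1))) = q / 4 * (|γ| / (|γ| + 1)) := by
            field_simp
        _ ≤ q / 4 * 1 := by gcongr
        _ = q / 4 := mul_one _
    have e3 : Real.log C + K ≤ q / 4 * x k := by
      have := mul_le_mul_of_nonneg_left hk3 (by positivity : (0 : ℝ) ≤ q / 4)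
      rw [← mul_assoc] at this
      have hq4 : q / 4 * (4 / q) = 1 := by field_simp
      rw [hq4, one_mul] at this
      exact this
    linarith
  -- Step 2: the eventual lower bound `m q /(2C) · x^{1-γ} ≤ rate`
  have hbound : ∀ᶠ k in atTop, m * q / (2 * C) * (x k) ^ (1 - γ) ≤ m / Z k * (ℓog k - Real.log (Z k) - K) := by
    have h4 : ∀ᶠ k in atTop, (1 : ℝ) ≤ x k := hx.eventually_ge_atTop _
    filter_upwards [hZ, hℓ, hlog, h4] with k hkZ hkℓ hkl hk1
    have hxpos : 0 < x k := by linarith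
    have hxγ : 0 < (x k) ^ γ := Real.rpow_pos_of_pos hxpos γ
    -- log Z ≤ log C + γ log x ≤ log C + |γ| |log x| ; here log x ≥ 0
    have hlx : 0 ≤ Real.log (x k) := Real.log_nonneg hk1
    have hlogZ : Real.log (Z k) ≤ Real.log C + |γ| * Real.log (x k) := by
      have := Real.log_le_log (hZpos k) hkZ
      rw [Real.log_mul hC.ne' hxγ.ne', Real.log_rpow hxpos] at this
      have hγl : γ * Real.log (x k) ≤ |γ| * Real.log (x k) :=
        mul_le_mul_of_nonneg_right (le_abs_self γ) hlx
      linarith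
    have hbr : q / 2 * x k ≤ ℓog k - Real.log (Z k) - K := by linarith
    have hbr0 : 0 ≤ ℓog k - Real.log (Z k) - K := le_trans (by positivity) hbr
    -- 1/Z ≥ 1/(C x^γ)
    have hinv : 1 / (C * (x k) ^ γ) ≤ 1 / Z k := one_div_le_one_div_of_le (hZpos k) hkZ
    have hsplit : (x k) ^ (1 - γ) = x k / (x k) ^ γ := by
      rw [Real.rpow_sub hxpos, Real.rpow_one]
    calc m * q / (2 * C) * (x k) ^ (1 - γ)
        = (m * (1 / (C * (x k) ^ γ))) * (q / 2 * x k) := by rw [hsplit]; field_simp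
      _ ≤ (m * (1 / Z k)) * (ℓog k - Real.log (Z k) - K) := by
          apply mul_le_mul (mul_le_mul_of_nonneg_left hinv hm.le) hbr (by positivity)
          exact mul_nonneg hm.le (by rw [one_div]; exact inv_nonneg.2 (hZpos k).le)
      _ = m / Z k * (ℓog k - Real.log (Z k) - K) := by rw [mul_one_div]
  -- Step 3: the minorant tends to `+∞`
  have hmin : Tendsto (fun k => m * q / (2 * C) * (x k) ^ (1 - γ)) atTop atTop := by
    have hpow : Tendsto (fun k => (x k) ^ (1 - γ)) atTop atTop :=
      (tendsto_rpow_atTop (by linarith : (0 : ℝ) < 1 - γ)).comp hx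
    exact hpow.const_mul_atTop (by positivity)
  exact tendsto_atTop_mono' atTop hbound hmin

/-! ## §5 Crux-facing targets (typed over tree objects; `sorry` = the statements the line must prove) -/

section Targets

variable {Nf : ℕ}

/-- W4's bad-box predicate at level `E` (verbatim the two sides of the landed `stub_badBoxLocal`): the taxi
ball of radius `r` about `x₀` supports a non-zero quasi-mode of `Γ₅D_W(U, m₀, 1)` strictly below level `E`.
A WELL is a bad box at the window level `E = w`; a `τ`-RESONANT well is a bad box at level `E = τ ≪ w`.
[folklore] -/
def IsBadBox {S : ℕ} (U : GaugeConfig 4 (2 * S + 1) SU3) (m₀ E : ℝ) (x₀ : TorusSite 4 (2 * S + 1)) (r : ℕ) :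
    Prop :=
  ∃ φ : Idx (2 * S + 1) 3 → ℂ, φ ≠ 0 ∧ (∀ p, r < torusTaxiDist p.1 x₀ → φ p = 0) ∧
    ∑ p, ‖(hermitianWilsonDirac (fundamentalRep (Fin 3)) U m₀ 1 *ᵥ φ) p‖ ^ 2 < E ^ 2 * ∑ p, ‖φ p‖ ^ 2

/-- **Target NR (level scaling of wells under `⟨·⟩₊`; the card's ONLY probabilistic input in output form).**
Along an SD⁺-witness (only the bare trajectory enters the statement) there are `C, p` such that eventually in
`k`, on every torus `S ≥ L_k`, for every flavour `f`, box centre `x₀`, radius `r` and depth `0 < τ ≤ w_f(k)/4`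
(`w_f(k) = c a_k m_f/Z_k`): the phase-quenched probability that the box is bad at level `τ` is at most
`C (log a_k⁻¹)^p · (τ / w_f(k)) ·` the phase-quenched probability that it is bad at level `w_f(k)`.  Intended
proof: `tilt_lintegral` with `n = n_f ≥ 1` on the box fibre (exterior frozen) + fixed-quantile anti-concentration
of the quenched conditional law with inverse-polylog probability + locality of the spectator determinant ratio
(clean-reference `DetRatioLocal` + W3 tails). [difficulty: L] -/
theorem levelScaling_target (reg : QCDRegularisation Nf) (c : ℝ) (m : Fin Nf → ℝ) :
    ∃ C p : ℝ, 0 < C ∧ ∀ᶠ k : ℕ in atTop, ∀ S : ℕ, reg.L k ≤ S →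
      ∀ (f : Fin Nf) (x₀ : TorusSite 4 (2 * S + 1)) (r : ℕ) (τ : ℝ), 0 < τ →
        τ ≤ c * (reg.a k * m f / reg.Zm k) / 4 →
        qcdPhaseQuenchedExpect (reg.β k) (2 * S + 1) (fun fl => reg.mcrit k + reg.a k * m fl / reg.Zm k)
            (fun U : GaugeConfig 4 (2 * S + 1) SU3 =>
              if IsBadBox U (reg.mcrit k + reg.a k * m f / reg.Zm k) τ x₀ r then (1 : ℝ) else 0) ≤
          C * Real.log ((reg.a k)⁻¹) ^ p * (τ / (c * (reg.a k * m f / reg.Zm k))) *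
            qcdPhaseQuenchedExpect (reg.β k) (2 * S + 1) (fun fl => reg.mcrit k + reg.a k * m fl / reg.Zm k)
              (fun U : GaugeConfig 4 (2 * S + 1) SU3 =>
                if IsBadBox U (reg.mcrit k + reg.a k * m f / reg.Zm k) (c * (reg.a k * m f / reg.Zm k)) x₀ r
                then (1 : ℝ) else 0) := by
  sorry

/-- **Target KS (KINEMATIC Fermi-projector screening in `⟨·⟩₊`-mean; the re-typed Stub 2⁺ of weyl-window).**
Same shape as the registered `WeylWindow.stub_fermiProjectorScreening`, but the rate is the KINEMATIC
`κ · (a_k m_f/Z_k)` per lattice unit and the constant may grow polynomially in `Z_k/a_k`: this is what landed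
W1–W4 + Combes–Thomas + Target NR give (Aizenman–Graf chain p108317–p111342 unchanged), and by `rate_diverges`
it is all the sign-defect Kotecký–Preiss step needs under POLYGROWTH. [difficulty: L] -/
theorem kinematicScreening_target (reg : QCDRegularisation Nf) (c : ℝ) (m : Fin Nf → ℝ) :
    ∃ κ C p : ℝ, 0 < κ ∧ 0 < C ∧ ∀ᶠ k : ℕ in atTop, ∀ S : ℕ, reg.L k ≤ S →
      ∀ (f : Fin Nf) (x y : TorusSite 4 (2 * S + 1)),
        qcdPhaseQuenchedExpect (reg.β k) (2 * S + 1) (fun fl => reg.mcrit k + reg.a k * m fl / reg.Zm k)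
            (fun U : GaugeConfig 4 (2 * S + 1) SU3 => ∑ p : Fin 3 × Fin 4, ∑ q : Fin 3 × Fin 4,
              ‖(cfc Real.sign (spinorLift gammaFive * wilsonDirac (fundamentalRep (Fin 3)) U
                  (reg.mcrit k + reg.a k * m f / reg.Zm k) 1) :
                Matrix (TorusSite 4 (2 * S + 1) × Fin 3 × Fin 4) (TorusSite 4 (2 * S + 1) × Fin 3 × Fin 4) ℂ)
                (x, p) (y, q)‖) ≤
          C * ((reg.a k)⁻¹ * reg.Zm k) ^ p *
            Real.exp (-(κ * (c * (reg.a k * m f / reg.Zm k)) * (torusTaxiDist x y : ℝ))) := by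
  sorry

end Targets

end Summit.QuantumFields.QCD.Cruxes.ExtinctionBuildsQCD.DeterminantTilt

end
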